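import Literature.Geometry.Lorentzian.StationaryOrbitHorizontalFlow
import Literature.Geometry.Lorentzian.U1Reduction
import HarnessLib

/-!
# The quotient metric `g_S` of a chronological stationary spacetime, pointwise
(Anderson 2000, §0: "`g_M` restricted to the horizontal subspaces … induces a Riemannian metric
`g_S` on `S`")

M. T. Anderson, *On stationary vacuum solutions to the Einstein equations*, Ann. Henri Poincaré 1
(2000), §0: "The metric `g = g_M` restricted to the horizontal subspaces of `TM`, i.e. the
orthogonal complement of `⟨X⟩ ⊂ TM` then induces a Riemannian metric `g_S` on `S`." For a bundled
four-dimensional spacetime `𝓢` with a complete Killing field `X` timelike at every point and the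
chronology condition — the hypotheses of `Anderson2000_completeStationaryVacuumFlat` that concern
the group action — the orbit space `S = OrbitSpace X` is a smooth 3-manifold
(`StationaryOrbitSpaceManifold.lean`), `π = orbitProj X` a `C^∞` submersion with `ker dπ = ℝ·X`
and a unique horizontal lift (`StationaryOrbitProjection.lean`, `StationaryOrbitHorizontal.lean`),
flow-equivariant and with `g` constant on lifts along orbits (`StationaryOrbitHorizontalFlow.lean`).
This file defines `g_S` **pointwise** and proves that it is a Euclidean inner product on every
tangent space `T_z S = ℝ³`, computed from any representative event:

* `Spacetime.IsStationaryKilling.horizontalLift hX hchr y ζ` — **the horizontal lift `H_y ζ`** of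
  `ζ ∈ T_{π y} S = ℝ³` at the event `y` (chosen by `existsUnique_horizontal_lift`), with
  `horizontalLift_horizontal` (`g(H ζ, X) = 0`), `mfderiv_orbitProj_horizontalLift`
  (`dπ(H ζ) = ζ`), `eq_horizontalLift` (uniqueness), linearity `horizontalLift_add`,
  `horizontalLift_smul`, `horizontalLift_zero`, `horizontalLift_injective`, and flow-equivariance
  `horizontalLift_flow` (`H_{θₜ y} ζ = dθₜ(H_y ζ)`);
* `Spacetime.IsStationaryKilling.quotientMetricVal hX hchr z ζ ζ'` — **`g_S` at the point `z` of
  the orbit space**: `g(H ζ, H ζ')` at the representative `z.out`;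
  `quotientMetricVal_eq` — it equals `g_y(H_y ζ, H_y ζ')` at **every** event `y` of the orbit `z`
  (`val_horizontal_lift_flow`: the flow maps are isometries intertwining horizontal lifts);
* `quotientMetricVal_symm`, `quotientMetricVal_add_left`, `quotientMetricVal_smul_left` — `g_S(z)`
  is a symmetric bilinear form on `ℝ³`; `quotientMetricVal_self_pos` — **positive definite**
  (`g > 0` on non-zero horizontal vectors, `val_pos_of_horizontal`, and `H` is injective):
  `g_S(z)` is a Euclidean inner product on `T_z S` — Anderson's "Riemannian metric `g_S` on `S`",
  pointwise.

* `horizontalLift_mfderiv_orbitProj` — `H(dπ v) = v − λ⁻¹ g(X, v) X` is the `g`-orthogonal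
  projection off `X` (`λ = g(X, X)`); hence `quotientMetricVal_mfderiv_orbitProj` — **Geroch's
  orbit-space form is the pullback of `g_S`**: `g_S(π y)(dπ v, dπ w) = h_y(v, w)` with
  `h = g − λ⁻¹ X♭ ⊗ X♭ = PseudoRiemannianMetric.orbitBilin g X` (`U1Reduction.lean`; Geroch 1971,
  App. A), linking the quotient manifold with the tensor calculus on `M` used in the `U(1)`
  reduction.

Not here: the smoothness of `z ↦ g_S(z)` as a section over the manifold `S` (i.e. `g_S` as a
`PseudoRiemannianMetric`/Riemannian metric of the prelude on `OrbitSpace X`), the lapse and twist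
data `(u, θ)` on `S`, and Lemma 1.1. The definitions depend on the hypotheses `hX`, `hchr` and on
choices (representatives, the chosen flow `hX.flow`), like the charted-space structure they live on.

## References

* M. T. Anderson, Ann. Henri Poincaré 1 (2000) 977–994, arXiv:gr-qc/0001091, §0 (key
  `Anderson2000`).
* B. O'Neill, *Semi-Riemannian geometry* (1983), Ch. 7, Def. 7.44 ff. (semi-Riemannian
  submersions) (key `ONeill1983`).
* R. Geroch, *A method for generating solutions of Einstein's equations*, J. Math. Phys. 12 (1971)
  918–924, App. A (the metric `h_{ab} = g_{ab} − λ⁻¹ ξ_a ξ_b` on the space of orbits) (key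
  `Geroch1971`).
-/

noncomputable section

open Bundle Set Filter Function Manifold TopologicalSpace
open scoped ContDiff Topology Manifold

namespace Literature.Geometry.Lorentzian

namespace Spacetime

universe u

variable {𝓢 : Spacetime.{u} 4} [𝓢.metric.HasLeviCivita]
  {X : Π x : 𝓢.carrier, TangentSpace (𝓡 4) x}

/-! ### The horizontal lift -/

/-- **The horizontal lift `H_y ζ`** at the event `y` of a tangent vector `ζ ∈ T_{π y} S = ℝ³` of the
orbit space of a chronological stationary spacetime: the unique tangent vector at `y` which is
`g`-orthogonal to the Killing vector `X y` and projects to `ζ` under `dπ_y`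
(`existsUnique_horizontal_lift`). Anderson 2000, §0–§1.1 (the horizontal distribution
`𝓗 = ⟨X⟩^⊥`). [cite: Anderson2000, §1.1] -/
def IsStationaryKilling.horizontalLift (hX : 𝓢.IsStationaryKilling X univ)
    (hchr : 𝓢.metric.IsChronological 𝓢.timeOrientation) (y : 𝓢.carrier)
    (ζ : EuclideanSpace ℝ (Fin 3)) : TangentSpace (𝓡 4) y :=
  Classical.choose (hX.existsUnique_horizontal_lift hchr y ζ).exists

/-- The horizontal lift is horizontal: `g(H_y ζ, X y) = 0`. [cite: Anderson2000, §1.1] -/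
theorem IsStationaryKilling.horizontalLift_horizontal (hX : 𝓢.IsStationaryKilling X univ)
    (hchr : 𝓢.metric.IsChronological 𝓢.timeOrientation) (y : 𝓢.carrier)
    (ζ : EuclideanSpace ℝ (Fin 3)) :
    𝓢.metric.val y (hX.horizontalLift hchr y ζ) (X y) = 0 :=
  (Classical.choose_spec (hX.existsUnique_horizontal_lift hchr y ζ).exists).1

/-- The horizontal lift projects back: `dπ_y(H_y ζ) = ζ`. [cite: Anderson2000, §1.1] -/
theorem IsStationaryKilling.mfderiv_orbitProj_horizontalLift (hX : 𝓢.IsStationaryKilling X univ)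
    (hchr : 𝓢.metric.IsChronological 𝓢.timeOrientation) (y : 𝓢.carrier)
    (ζ : EuclideanSpace ℝ (Fin 3)) :
    letI := hX.orbitSpaceChartedSpace hchr
    mfderiv (𝓡 4) (𝓡 3) (orbitProj X) y (hX.horizontalLift hchr y ζ) = ζ :=
  (Classical.choose_spec (hX.existsUnique_horizontal_lift hchr y ζ).exists).2

/-- **Uniqueness of the horizontal lift**: a horizontal vector projecting to `ζ` is `H_y ζ`.
[cite: Anderson2000, §1.1] -/
theorem IsStationaryKilling.eq_horizontalLift (hX : 𝓢.IsStationaryKilling X univ)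
    (hchr : 𝓢.metric.IsChronological 𝓢.timeOrientation) {y : 𝓢.carrier}
    {ζ : EuclideanSpace ℝ (Fin 3)} {v : TangentSpace (𝓡 4) y}
    (hv : 𝓢.metric.val y v (X y) = 0)
    (hvζ : letI := hX.orbitSpaceChartedSpace hchr; mfderiv (𝓡 4) (𝓡 3) (orbitProj X) y v = ζ) :
    v = hX.horizontalLift hchr y ζ :=
  (hX.existsUnique_horizontal_lift hchr y ζ).unique ⟨hv, hvζ⟩
    ⟨hX.horizontalLift_horizontal hchr y ζ, hX.mfderiv_orbitProj_horizontalLift hchr y ζ⟩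

/-- The horizontal lift is additive (uniqueness). [folklore] -/
theorem IsStationaryKilling.horizontalLift_add (hX : 𝓢.IsStationaryKilling X univ)
    (hchr : 𝓢.metric.IsChronological 𝓢.timeOrientation) (y : 𝓢.carrier)
    (ζ ζ' : EuclideanSpace ℝ (Fin 3)) :
    hX.horizontalLift hchr y (ζ + ζ') = hX.horizontalLift hchr y ζ + hX.horizontalLift hchr y ζ' := by
  symm
  refine hX.eq_horizontalLift hchr ?_ ?_
  · rw [map_add]
    change 𝓢.metric.val y (hX.horizontalLift hchr y ζ) (X y) +
      𝓢.metric.val y (hX.horizontalLift hchr y ζ') (X y) = 0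
    rw [hX.horizontalLift_horizontal, hX.horizontalLift_horizontal, add_zero]
  · letI := hX.orbitSpaceChartedSpace hchr
    rw [map_add, hX.mfderiv_orbitProj_horizontalLift, hX.mfderiv_orbitProj_horizontalLift]
    rfl

/-- The horizontal lift is homogeneous (uniqueness). [folklore] -/
theorem IsStationaryKilling.horizontalLift_smul (hX : 𝓢.IsStationaryKilling X univ)
    (hchr : 𝓢.metric.IsChronological 𝓢.timeOrientation) (y : 𝓢.carrier) (c : ℝ)
    (ζ : EuclideanSpace ℝ (Fin 3)) :
    hX.horizontalLift hchr y (c • ζ) = c • hX.horizontalLift hchr y ζ := by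
  symm
  refine hX.eq_horizontalLift hchr ?_ ?_
  · rw [map_smul]
    change c • 𝓢.metric.val y (hX.horizontalLift hchr y ζ) (X y) = 0
    rw [hX.horizontalLift_horizontal, smul_zero]
  · letI := hX.orbitSpaceChartedSpace hchr
    rw [map_smul, hX.mfderiv_orbitProj_horizontalLift]
    rfl

/-- The horizontal lift of `0` is `0`. [folklore] -/
theorem IsStationaryKilling.horizontalLift_zero (hX : 𝓢.IsStationaryKilling X univ)
    (hchr : 𝓢.metric.IsChronological 𝓢.timeOrientation) (y : 𝓢.carrier) :
    hX.horizontalLift hchr y 0 = 0 := by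
  have h := hX.horizontalLift_smul hchr y 0 0
  rwa [zero_smul, zero_smul] at h

/-- **The horizontal lift is injective** (`dπ ∘ H = id`): `dπ_y` is a linear isomorphism
`𝓗_y ≅ T_{π y} S` with inverse `H_y`. [cite: Anderson2000, §1.1] -/
theorem IsStationaryKilling.horizontalLift_injective (hX : 𝓢.IsStationaryKilling X univ)
    (hchr : 𝓢.metric.IsChronological 𝓢.timeOrientation) (y : 𝓢.carrier) :
    Injective (hX.horizontalLift hchr y) := by
  intro ζ ζ' h
  letI := hX.orbitSpaceChartedSpace hchr
  rw [← hX.mfderiv_orbitProj_horizontalLift hchr y ζ, ← hX.mfderiv_orbitProj_horizontalLift hchr y ζ',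
    h]

/-- **The horizontal lift is flow-equivariant**: `H_{θₜ y} ζ = dθₜ(H_y ζ)` for the stationary flow
`θ = hX.flow` (`horizontal_lift_flow_eq`). [cite: Anderson2000, §1.1] -/
theorem IsStationaryKilling.horizontalLift_flow (hX : 𝓢.IsStationaryKilling X univ)
    (hchr : 𝓢.metric.IsChronological 𝓢.timeOrientation) (t : ℝ) (y : 𝓢.carrier)
    (ζ : EuclideanSpace ℝ (Fin 3)) :
    hX.horizontalLift hchr (hX.flow (t, y)) ζ =
      mfderiv (𝓡 4) (𝓡 4) (fun q ↦ hX.flow (t, q)) y (hX.horizontalLift hchr y ζ) :=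
  LorentzianMetric.IsStationaryKilling.horizontal_lift_flow_eq hX hchr hX.contMDiff_flow hX.flow_zero
    hX.flow_add hX.isMIntegralCurve_flow (by simp [finrank_euclideanSpace]) t y ζ
    ⟨hX.horizontalLift_horizontal hchr y ζ, hX.mfderiv_orbitProj_horizontalLift hchr y ζ⟩
    ⟨hX.horizontalLift_horizontal hchr _ ζ, hX.mfderiv_orbitProj_horizontalLift hchr _ ζ⟩

/-! ### The quotient metric at a point of the orbit space -/

/-- **Anderson's quotient metric `g_S`, pointwise.** For a point `z` of the orbit space and tangent
vectors `ζ, ζ' ∈ T_z S = ℝ³`: `g_S(z)(ζ, ζ') := g(H ζ, H ζ')`, the space-time metric on the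
horizontal lifts at the representative event `z.out` of the orbit — independent of the
representative by `quotientMetricVal_eq`. Anderson 2000, §0: "`g_M` restricted to the horizontal
subspaces of `TM` … induces a Riemannian metric `g_S` on `S`". [cite: Anderson2000, §0] -/
def IsStationaryKilling.quotientMetricVal (hX : 𝓢.IsStationaryKilling X univ)
    (hchr : 𝓢.metric.IsChronological 𝓢.timeOrientation) (z : OrbitSpace X)
    (ζ ζ' : EuclideanSpace ℝ (Fin 3)) : ℝ :=
  𝓢.metric.val z.out (hX.horizontalLift hchr z.out ζ) (hX.horizontalLift hchr z.out ζ')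

/-- **`g_S` may be computed at any event of the orbit**: if `π y = z` then
`g_S(z)(ζ, ζ') = g_y(H_y ζ, H_y ζ')`. The representative `z.out` and `y` lie on one orbit, so
`z.out = θₜ y` for the stationary flow; horizontal lifts are intertwined by `dθₜ` and `θₜ` is an
isometry (`val_horizontal_lift_flow`). This is the well-definedness of the quotient metric.
[cite: Anderson2000, §0] -/
theorem IsStationaryKilling.quotientMetricVal_eq (hX : 𝓢.IsStationaryKilling X univ)
    (hchr : 𝓢.metric.IsChronological 𝓢.timeOrientation) {z : OrbitSpace X} {y : 𝓢.carrier}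
    (hy : orbitProj X y = z) (ζ ζ' : EuclideanSpace ℝ (Fin 3)) :
    hX.quotientMetricVal hchr z ζ ζ' =
      𝓢.metric.val y (hX.horizontalLift hchr y ζ) (hX.horizontalLift hchr y ζ') := by
  -- `z.out` lies on the orbit of `y`
  have hX1 := hX.contMDiff_one
  have hc : IsCompleteVectorField X := fun x ↦
    ⟨fun t ↦ hX.flow (t, x), hX.isMIntegralCurve_flow x, hX.flow_zero x⟩
  have hmem : z.out ∈ Literature.Geometry.Lorentzian.stationaryOrbit X {y} := by
    rw [← orbitProj_eq_iff X hX1 hc, hy]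
    exact (Quotient.out_eq z).symm
  obtain ⟨t, ht⟩ := (mem_stationaryOrbit_singleton_iff_exists_flow_eq hX1
    hX.isMIntegralCurve_flow hX.flow_zero).1 hmem
  have key := hX.val_horizontal_lift_flow hchr t y ζ ζ'
    ⟨hX.horizontalLift_horizontal hchr y ζ, hX.mfderiv_orbitProj_horizontalLift hchr y ζ⟩
    ⟨hX.horizontalLift_horizontal hchr y ζ', hX.mfderiv_orbitProj_horizontalLift hchr y ζ'⟩
    ⟨hX.horizontalLift_horizontal hchr _ ζ, hX.mfderiv_orbitProj_horizontalLift hchr _ ζ⟩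
    ⟨hX.horizontalLift_horizontal hchr _ ζ', hX.mfderiv_orbitProj_horizontalLift hchr _ ζ'⟩
  rw [ht] at key
  exact key

/-- `g_S(z)` is symmetric. [cite: Anderson2000, §0] -/
theorem IsStationaryKilling.quotientMetricVal_symm (hX : 𝓢.IsStationaryKilling X univ)
    (hchr : 𝓢.metric.IsChronological 𝓢.timeOrientation) (z : OrbitSpace X)
    (ζ ζ' : EuclideanSpace ℝ (Fin 3)) :
    hX.quotientMetricVal hchr z ζ ζ' = hX.quotientMetricVal hchr z ζ' ζ :=
  𝓢.metric.symm _ _ _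

/-- `g_S(z)` is additive in the first slot. [folklore] -/
theorem IsStationaryKilling.quotientMetricVal_add_left (hX : 𝓢.IsStationaryKilling X univ)
    (hchr : 𝓢.metric.IsChronological 𝓢.timeOrientation) (z : OrbitSpace X)
    (ζ₁ ζ₂ ζ' : EuclideanSpace ℝ (Fin 3)) :
    hX.quotientMetricVal hchr z (ζ₁ + ζ₂) ζ' =
      hX.quotientMetricVal hchr z ζ₁ ζ' + hX.quotientMetricVal hchr z ζ₂ ζ' := by
  simp only [IsStationaryKilling.quotientMetricVal, hX.horizontalLift_add, map_add]
  rfl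

/-- `g_S(z)` is homogeneous in the first slot. [folklore] -/
theorem IsStationaryKilling.quotientMetricVal_smul_left (hX : 𝓢.IsStationaryKilling X univ)
    (hchr : 𝓢.metric.IsChronological 𝓢.timeOrientation) (z : OrbitSpace X) (c : ℝ)
    (ζ ζ' : EuclideanSpace ℝ (Fin 3)) :
    hX.quotientMetricVal hchr z (c • ζ) ζ' = c * hX.quotientMetricVal hchr z ζ ζ' := by
  simp only [IsStationaryKilling.quotientMetricVal, hX.horizontalLift_smul, map_smul]
  rfl

/-- **`g_S(z)` is positive definite**: `g_S(z)(ζ, ζ) > 0` for `ζ ≠ 0` — the horizontal lift of a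
non-zero vector is a non-zero vector orthogonal to the timelike `X`, hence spacelike
(`val_pos_of_horizontal`). Thus `g_S(z)` is a Euclidean inner product on `T_z S`: "a Riemannian
metric `g_S` on `S`" (Anderson 2000, §0), pointwise. [cite: Anderson2000, §0] -/
theorem IsStationaryKilling.quotientMetricVal_self_pos (hX : 𝓢.IsStationaryKilling X univ)
    (hchr : 𝓢.metric.IsChronological 𝓢.timeOrientation) (z : OrbitSpace X)
    {ζ : EuclideanSpace ℝ (Fin 3)} (hζ : ζ ≠ 0) : 0 < hX.quotientMetricVal hchr z ζ ζ := by
  have hH0 : hX.horizontalLift hchr z.out ζ ≠ 0 := by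
    intro h0
    apply hζ
    apply hX.horizontalLift_injective hchr z.out
    rw [h0, hX.horizontalLift_zero]
  exact LorentzianMetric.IsStationaryKilling.val_pos_of_horizontal hX
    (hX.horizontalLift_horizontal hchr z.out ζ) hH0

/-- `g_S(z)(ζ, ζ) ≥ 0`. [folklore] -/
theorem IsStationaryKilling.quotientMetricVal_self_nonneg (hX : 𝓢.IsStationaryKilling X univ)
    (hchr : 𝓢.metric.IsChronological 𝓢.timeOrientation) (z : OrbitSpace X)
    (ζ : EuclideanSpace ℝ (Fin 3)) : 0 ≤ hX.quotientMetricVal hchr z ζ ζ := by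
  by_cases hζ : ζ = 0
  · subst hζ
    simp [IsStationaryKilling.quotientMetricVal, hX.horizontalLift_zero]
  · exact (hX.quotientMetricVal_self_pos hchr z hζ).le

/-- `g_S(z)(ζ, ζ) = 0` iff `ζ = 0` (definiteness). [folklore] -/
theorem IsStationaryKilling.quotientMetricVal_self_eq_zero_iff (hX : 𝓢.IsStationaryKilling X univ)
    (hchr : 𝓢.metric.IsChronological 𝓢.timeOrientation) (z : OrbitSpace X)
    (ζ : EuclideanSpace ℝ (Fin 3)) : hX.quotientMetricVal hchr z ζ ζ = 0 ↔ ζ = 0 := by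
  constructor
  · intro h0
    by_contra hζ
    exact (hX.quotientMetricVal_self_pos hchr z hζ).ne' h0
  · rintro rfl
    simp [IsStationaryKilling.quotientMetricVal, hX.horizontalLift_zero]

/-! ### Geroch's orbit-space form `h = g − λ⁻¹ X♭ ⊗ X♭` is the pullback `π^* g_S` -/

/-- **The horizontal lift of `dπ v` is the orthogonal projection of `v` off `X`**:
`H_y(dπ_y v) = v − λ⁻¹ g(X, v) X`, `λ = g(X, X)` (the right-hand side is horizontal and `dπ` kills
`X`; uniqueness of the lift). Geroch 1971, App. A (the projector `h^a_b = δ^a_b − λ⁻¹ ξ^a ξ_b`).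
[cite: Geroch1971, App. A] -/
theorem IsStationaryKilling.horizontalLift_mfderiv_orbitProj (hX : 𝓢.IsStationaryKilling X univ)
    (hchr : 𝓢.metric.IsChronological 𝓢.timeOrientation) (y : 𝓢.carrier)
    (v : TangentSpace (𝓡 4) y) :
    letI := hX.orbitSpaceChartedSpace hchr
    hX.horizontalLift hchr y (mfderiv (𝓡 4) (𝓡 3) (orbitProj X) y v) =
      v - ((𝓢.metric.val y (X y) (X y))⁻¹ * 𝓢.metric.val y (X y) v) • X y := by
  letI := hX.orbitSpaceChartedSpace hchr
  have hXX : 𝓢.metric.val y (X y) (X y) ≠ 0 := (hX.isTimelike (mem_univ y)).1.ne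
  symm
  refine hX.eq_horizontalLift hchr ?_ ?_
  · rw [map_sub, map_smul, sub_apply, smul_apply, smul_eq_mul, 𝓢.metric.symm y v (X y)]
    field_simp
    ring
  · have h0 : mfderiv (𝓡 4) (𝓡 3) (orbitProj X) y (X y) = 0 :=
      LorentzianMetric.IsStationaryKilling.mfderiv_orbitProj_apply_self hX hchr hX.contMDiff_flow
        hX.flow_zero hX.flow_add hX.isMIntegralCurve_flow (by simp [finrank_euclideanSpace]) y
    rw [map_sub, map_smul, h0, smul_zero, sub_zero]

/-- **Geroch's orbit-space form is the pullback of the quotient metric: `π^* g_S = h`.** For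
tangent vectors `v, w` at an event `y`,
`g_S(π y)(dπ v, dπ w) = g(v, w) − λ⁻¹ g(X, v) g(X, w) = h_y(v, w)`, where
`h = g − λ⁻¹ X♭ ⊗ X♭ = PseudoRiemannianMetric.orbitBilin g X` is the form of `U1Reduction.lean`
(Geroch 1971, App. A: "`h_{ab} = g_{ab} − λ⁻¹ ξ_a ξ_b` … is a metric on `S`"; Anderson 2000, §0). This
identifies the abstract Riemannian quotient `(S, g_S)` with the tensor `h` on `M` used in the
`U(1)`/Geroch reduction of the stationary vacuum equations. [cite: Geroch1971, App. A] -/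
theorem IsStationaryKilling.quotientMetricVal_mfderiv_orbitProj (hX : 𝓢.IsStationaryKilling X univ)
    (hchr : 𝓢.metric.IsChronological 𝓢.timeOrientation) (y : 𝓢.carrier)
    (v w : TangentSpace (𝓡 4) y) :
    letI := hX.orbitSpaceChartedSpace hchr
    hX.quotientMetricVal hchr (orbitProj X y) (mfderiv (𝓡 4) (𝓡 3) (orbitProj X) y v)
        (mfderiv (𝓡 4) (𝓡 3) (orbitProj X) y w) =
      𝓢.metric.toPseudoRiemannianMetric.orbitBilin X y v w := by
  letI := hX.orbitSpaceChartedSpace hchr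
  have hXX : 𝓢.metric.val y (X y) (X y) ≠ 0 := (hX.isTimelike (mem_univ y)).1.ne
  rw [hX.quotientMetricVal_eq hchr rfl, hX.horizontalLift_mfderiv_orbitProj,
    hX.horizontalLift_mfderiv_orbitProj, PseudoRiemannianMetric.orbitBilin_apply,
    PseudoRiemannianMetric.sqNorm_apply]
  simp only [map_sub, map_smul, sub_apply, smul_apply, smul_eq_mul]
  rw [𝓢.metric.symm y v (X y)]
  field_simp
  ring

end Spacetime

end Literature.Geometry.Lorentzian

end
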